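import Summits.QuantumAdvantage.QuantumAdvantage.Theorems.SosSandwichOneQueryFrameAAFourier

/-!
# Route `SosSandwich`: support item `OneQueryFrameAA` (stmt-QuantumAdvantage-15240) — the `T = 1` theorem

If `p` and `1 - p` are, on the cube, sums of squares of polynomials of total degree `≤ 1`, then
`4·Var[p]² ≤ 9·maxᵢ Infᵢ[p]` (tree conventions). Proof: flat Gram matrix `0 ≼ M ≼ D` (part 1 supplies the
Walsh–Fourier bookkeeping and `quad_le_of_flat`); two test vectors give `V₁² ≤ τ`, `V₂ ≤ √τ/2`.
-/

set_option linter.dupNamespace false -- D-0017: single-problem summit ⇒ `QuantumAdvantage.QuantumAdvantage` by design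

namespace Summit.QuantumAdvantage.QuantumAdvantage.Theorems.SosSandwich

open Finset MvPolynomial Literature.Computability.QuantumComplexity Literature.Computability.Complexity.LowDegree
  Literature.Probability.RandomGraphs.LowDegree
open scoped symmDiff

variable {N : ℕ}

set_option maxHeartbeats 1600000 in
/-- **Core of `OneQueryFrameAA`**: an order-`1` SOS sandwich certificate for `p` forces
`4·Var[p]² ≤ 9·Inf_{i₀}[p]` for any influence-maximising variable `i₀`.
[cite: ODonnell2014, §1.4 and §2.2] -/
theorem four_var_sq_le_nine_maxInf {p : MvPolynomial (Fin N) ℝ} {m : ℕ}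
    (q r : Fin m → MvPolynomial (Fin N) ℝ)
    (hdeg : ∀ j, (q j).totalDegree ≤ 1 ∧ (r j).totalDegree ≤ 1)
    (hval : ∀ x, evalBool p x = ∑ j, evalBool (q j) x ^ 2 ∧
      1 - evalBool p x = ∑ j, evalBool (r j) x ^ 2)
    (i₀ : Fin N) (hmax : ∀ k, influence k p ≤ influence i₀ p) :
    4 * boolVariance p ^ 2 ≤ 9 * influence i₀ p := by
  classical
  obtain ⟨a, ha⟩ : ∃ a : Finset (Fin N) → ℝ, a = cubeFourierCoeff (evalBool p) := ⟨_, rfl⟩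
  obtain ⟨α, hα⟩ : ∃ α : Fin m → Finset (Fin N) → ℝ,
      α = fun j => cubeFourierCoeff (evalBool (q j)) := ⟨_, rfl⟩
  obtain ⟨γ, hγ⟩ : ∃ γ : Fin m → Finset (Fin N) → ℝ,
      γ = fun j => cubeFourierCoeff (evalBool (r j)) := ⟨_, rfl⟩
  obtain ⟨τ, hτ⟩ : ∃ τ : ℝ, τ = influence i₀ p := ⟨_, rfl⟩
  have hαj : ∀ j S, cubeFourierCoeff (evalBool (q j)) S = α j S := fun j S => by rw [hα]
  have hγj : ∀ j S, cubeFourierCoeff (evalBool (r j)) S = γ j S := fun j S => by rw [hγ]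
  have hα2 : ∀ j (S : Finset (Fin N)), 2 ≤ S.card → cubeFourierCoeff (evalBool (q j)) S = 0 :=
    fun j S hS => fc_eq_zero_of_deg_le_one (hdeg j).1 hS
  have hγ2 : ∀ j (S : Finset (Fin N)), 2 ≤ S.card → cubeFourierCoeff (evalBool (r j)) S = 0 :=
    fun j S hS => fc_eq_zero_of_deg_le_one (hdeg j).2 hS
  have hα2' : ∀ j (S : Finset (Fin N)), 2 ≤ S.card → α j S = 0 := fun j S hS => by
    rw [← hαj]; exact hα2 j S hS
  have hγ2' : ∀ j (S : Finset (Fin N)), 2 ≤ S.card → γ j S = 0 := fun j S hS => by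
    rw [← hγj]; exact hγ2 j S hS
  have hF : evalBool p = fun x => ∑ j, evalBool (q j) x * evalBool (q j) x := by
    funext x; rw [(hval x).1]; exact Finset.sum_congr rfl fun j _ => sq _
  have hG : (fun x => 1 - evalBool p x) = fun x => ∑ j, evalBool (r j) x * evalBool (r j) x := by
    funext x; rw [(hval x).2]; exact Finset.sum_congr rfl fun j _ => sq _
  have haU : ∀ U, a U = ∑ j, cubeFourierCoeff (fun x => evalBool (q j) x * evalBool (q j) x) U := by
    intro U; rw [ha, hF, cubeFourierCoeff_sum]
  have hbU : ∀ U : Finset (Fin N), (if U = ∅ then (1 : ℝ) else 0) - a U =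
      ∑ j, cubeFourierCoeff (fun x => evalBool (r j) x * evalBool (r j) x) U := by
    intro U
    have e : cubeFourierCoeff (fun x => 1 - evalBool p x) U =
        cubeFourierCoeff (fun _ : Fin N → Bool => (1 : ℝ)) U - cubeFourierCoeff (evalBool p) U :=
      cubeFourierCoeff_sub (fun _ => 1) (evalBool p) U
    rw [fc_one, ← ha] at e
    rw [← e, hG, cubeFourierCoeff_sum]
  have ha1 : ∀ i, a {i} = 2 * ∑ j, α j ∅ * α j {i} := by
    intro i; rw [haU, Finset.mul_sum]
    refine Finset.sum_congr rfl fun j _ => ?_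
    rw [fc_mul_singleton (hα2 j) (hα2 j), hαj, hαj]; ring
  have ha2 : ∀ i k, i ≠ k → a {i, k} = 2 * ∑ j, α j {i} * α j {k} := by
    intro i k hik; rw [haU, Finset.mul_sum]
    refine Finset.sum_congr rfl fun j _ => ?_
    rw [fc_mul_pair (hα2 j) (hα2 j) hik, hαj, hαj]; ring
  have hb1 : ∀ i, -a {i} = 2 * ∑ j, γ j ∅ * γ j {i} := by
    intro i
    have h := hbU {i}
    rw [if_neg (Finset.singleton_ne_empty i), zero_sub] at h
    rw [h, Finset.mul_sum]
    refine Finset.sum_congr rfl fun j _ => ?_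
    rw [fc_mul_singleton (hγ2 j) (hγ2 j), hγj, hγj]; ring
  have hb2 : ∀ i k, i ≠ k → -a {i, k} = 2 * ∑ j, γ j {i} * γ j {k} := by
    intro i k hik
    have h := hbU {i, k}
    rw [if_neg (Finset.insert_ne_empty i {k}), zero_sub] at h
    rw [h, Finset.mul_sum]
    refine Finset.sum_congr rfl fun j _ => ?_
    rw [fc_mul_pair (hγ2 j) (hγ2 j) hik, hγj, hγj]; ring
  have ha0 : a ∅ = ∑ j, ∑ S, α j S * α j S := by
    rw [haU]; refine Finset.sum_congr rfl fun j _ => ?_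
    rw [fc_mul_empty]; simp only [hαj]
  have hb0 : 1 - a ∅ = ∑ j, ∑ S, γ j S * γ j S := by
    have h := hbU ∅
    rw [if_pos rfl] at h
    rw [h]; refine Finset.sum_congr rfl fun j _ => ?_
    rw [fc_mul_empty]; simp only [hγj]
  have hflat1 : ∀ i, ∑ j, (α j ∅ * α j {i} + γ j ∅ * γ j {i}) = 0 := by
    intro i; have h1 := ha1 i; have h2 := hb1 i
    rw [Finset.sum_add_distrib]; linarith
  have hflat2 : ∀ i k, i ≠ k → ∑ j, (α j {i} * α j {k} + γ j {i} * γ j {k}) = 0 := by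
    intro i k hik; have h1 := ha2 i k hik; have h2 := hb2 i k hik
    rw [Finset.sum_add_distrib]; linarith
  -- the diagonal d(S) = Σ_j (α_j(S)² + γ_j(S)²)
  obtain ⟨d, hd⟩ : ∃ d : Finset (Fin N) → ℝ, d = fun S => ∑ j, (α j S ^ 2 + γ j S ^ 2) := ⟨_, rfl⟩
  have hdS : ∀ S, d S = ∑ j, (α j S ^ 2 + γ j S ^ 2) := fun S => by rw [hd]
  have hd0 : ∀ S, 0 ≤ d S := fun S => by rw [hdS]; positivity
  have hdsum : ∑ S, d S = 1 := by
    have h : a ∅ + (1 - a ∅) = 1 := by ring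
    rw [hb0, ha0, ← Finset.sum_add_distrib] at h
    rw [← h]
    simp_rw [hdS]
    rw [Finset.sum_comm]
    refine Finset.sum_congr rfl fun j _ => ?_
    rw [Finset.sum_add_distrib]
    exact congrArg₂ (· + ·) (Finset.sum_congr rfl fun S _ => by ring)
      (Finset.sum_congr rfl fun S _ => by ring)
  have hd2 : ∀ S : Finset (Fin N), 2 ≤ S.card → d S = 0 := by
    intro S hS; rw [hdS]; simp [hα2' _ S hS, hγ2' _ S hS]
  have hdsplit : d ∅ + ∑ k, d {k} = 1 := by rw [← sum_level_le_one d hd2, hdsum]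
  have hdk_le : ∑ k, d {k} ≤ 1 := by have := hd0 ∅; linarith
  have hd0_le : d ∅ ≤ 1 := by
    have : 0 ≤ ∑ k, d {k} := Finset.sum_nonneg fun k _ => hd0 _
    linarith
  have hQI := quad_le_of_flat α γ d hdS hflat1 hflat2
  have hτk : ∀ k, influence k p ≤ τ := fun k => by rw [hτ]; exact hmax k
  have hτ0 : 0 ≤ τ := le_trans (influence_nonneg i₀ p) (hτk i₀)
  have hinf : ∀ k, influence k p = 4 * ∑ S ∈ Finset.univ.filter (fun S => k ∈ S), a S ^ 2 := by
    intro k; rw [influence_eq_sum_sq_fourier, ha]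
  have hak : ∀ k, a {k} ^ 2 ≤ τ / 4 := by
    intro k
    have h1 : a {k} ^ 2 ≤ ∑ S ∈ Finset.univ.filter (fun S => k ∈ S), a S ^ 2 :=
      Finset.single_le_sum (f := fun S => a S ^ 2) (fun S _ => sq_nonneg _) (by simp)
    have := hτk k; rw [hinf] at this; linarith
  have hpair : ∀ k, ∑ i ∈ Finset.univ.erase k, a {k, i} ^ 2 ≤ τ / 4 := by
    intro k
    have h1 : ∑ i ∈ Finset.univ.erase k, a {k, i} ^ 2 ≤
        ∑ S ∈ Finset.univ.filter (fun S => k ∈ S), a S ^ 2 := by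
      rw [← sum_pairs_containing k (fun S => a S ^ 2)]
      apply Finset.sum_le_sum_of_subset_of_nonneg
      · intro S hS; rw [Finset.mem_filter] at hS ⊢; exact ⟨hS.1, hS.2.2⟩
      · intro S _ _; exact sq_nonneg _
    have := hτk k; rw [hinf] at this; linarith
  -- level 1: V₁ = Σ_k a{k}² = 4 S₀ with S₀² ≤ d(∅)·B ≤ τ/16
  obtain ⟨m0, hm0⟩ : ∃ m0 : Fin N → ℝ, m0 = fun k => ∑ j, α j ∅ * α j {k} := ⟨_, rfl⟩
  have hm0k : ∀ k, m0 k = ∑ j, α j ∅ * α j {k} := fun k => by rw [hm0]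
  have ha1' : ∀ k, a {k} = 2 * m0 k := fun k => by rw [hm0k, ha1]
  have hm0sq : ∀ k, m0 k ^ 2 ≤ τ / 16 := by
    intro k; have := hak k; rw [ha1'] at this; nlinarith
  obtain ⟨S₀, hS₀⟩ : ∃ S₀ : ℝ, S₀ = ∑ k, m0 k ^ 2 := ⟨_, rfl⟩
  obtain ⟨B, hB⟩ : ∃ B : ℝ, B = ∑ k, m0 k ^ 2 * d {k} := ⟨_, rfl⟩
  have hS₀0 : 0 ≤ S₀ := by rw [hS₀]; positivity
  have hB0' : 0 ≤ B := by
    rw [hB]; exact Finset.sum_nonneg fun k _ => mul_nonneg (sq_nonneg _) (hd0 _)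
  have hBle : B ≤ τ / 16 := by
    rw [hB]
    calc ∑ k, m0 k ^ 2 * d {k} ≤ ∑ k, τ / 16 * d {k} :=
          Finset.sum_le_sum fun k _ => mul_le_mul_of_nonneg_right (hm0sq k) (hd0 _)
      _ = τ / 16 * ∑ k, d {k} := by rw [Finset.mul_sum]
      _ ≤ τ / 16 * 1 := mul_le_mul_of_nonneg_left hdk_le (by positivity)
      _ = τ / 16 := by ring
  have hP1 : ∀ s : ℝ, 2 * s * S₀ ≤ d ∅ + s ^ 2 * B := by
    intro s
    have h := hQI 1 (fun k => s * m0 k)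
    have hL : 2 * s * S₀ ≤ ∑ j, (1 * α j ∅ + ∑ k, (s * m0 k) * α j {k}) ^ 2 := by
      have e : ∀ j, 2 * s * (α j ∅ * ∑ k, m0 k * α j {k}) ≤
          (1 * α j ∅ + ∑ k, (s * m0 k) * α j {k}) ^ 2 := by
        intro j
        have e2 : ∑ k, (s * m0 k) * α j {k} = s * ∑ k, m0 k * α j {k} := by
          rw [Finset.mul_sum]; exact Finset.sum_congr rfl fun k _ => by ring
        rw [e2]
        nlinarith [sq_nonneg (α j ∅), sq_nonneg (s * ∑ k, m0 k * α j {k}),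
          sq_nonneg (α j ∅ - s * ∑ k, m0 k * α j {k})]
      have hsum : ∑ j, 2 * s * (α j ∅ * ∑ k, m0 k * α j {k}) = 2 * s * S₀ := by
        rw [← Finset.mul_sum, hS₀]
        congr 1
        have e3 : ∀ j, α j ∅ * ∑ k, m0 k * α j {k} = ∑ k, m0 k * (α j ∅ * α j {k}) := by
          intro j; rw [Finset.mul_sum]; exact Finset.sum_congr rfl fun k _ => by ring
        simp_rw [e3]; rw [Finset.sum_comm]
        refine Finset.sum_congr rfl fun k _ => ?_
        rw [← Finset.mul_sum, ← hm0k, sq]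
      rw [← hsum]; exact Finset.sum_le_sum fun j _ => e j
    have hR : (1 : ℝ) ^ 2 * d ∅ + ∑ k, (s * m0 k) ^ 2 * d {k} = d ∅ + s ^ 2 * B := by
      rw [hB, Finset.mul_sum, one_pow, one_mul]
      congr 1
      exact Finset.sum_congr rfl fun k _ => by ring
    linarith [hL, h, hR.le, hR.ge]
  have hS₀sq : S₀ ^ 2 ≤ d ∅ * B := sq_le_of_forall_quadratic hS₀0 hB0' hP1
  have hV1sq : (4 * S₀) ^ 2 ≤ τ := by
    have : d ∅ * B ≤ 1 * (τ / 16) := mul_le_mul hd0_le hBle hB0' (by norm_num)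
    nlinarith
  have hV1 : ∑ k, a {k} ^ 2 = 4 * S₀ := by
    rw [hS₀, Finset.mul_sum]; exact Finset.sum_congr rfl fun k _ => by rw [ha1']; ring
  -- level 2: ρ_i = Σ_{k≠i} M({i},{k})², ρ_i² ≤ d{i}·B_i, Σ_i B_i ≤ τ/16
  obtain ⟨mm, hmm⟩ : ∃ mm : Fin N → Fin N → ℝ, mm = fun i k => ∑ j, α j {i} * α j {k} := ⟨_, rfl⟩
  have hmmik : ∀ i k, mm i k = ∑ j, α j {i} * α j {k} := fun i k => by rw [hmm]
  have hmm_symm : ∀ i k, mm i k = mm k i := fun i k => by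
    rw [hmmik, hmmik]; exact Finset.sum_congr rfl fun j _ => mul_comm _ _
  have ha2' : ∀ i k, i ≠ k → a {i, k} = 2 * mm i k := fun i k h => by rw [hmmik, ha2 i k h]
  obtain ⟨ρ, hρ⟩ : ∃ ρ : Fin N → ℝ, ρ = fun i => ∑ k ∈ Finset.univ.erase i, mm i k ^ 2 := ⟨_, rfl⟩
  have hρi : ∀ i, ρ i = ∑ k ∈ Finset.univ.erase i, mm i k ^ 2 := fun i => by rw [hρ]
  have hρ0 : ∀ i, 0 ≤ ρ i := fun i => by rw [hρi]; positivity
  have hρle : ∀ i, ρ i ≤ τ / 16 := by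
    intro i
    have h := hpair i
    have e : ∑ k ∈ Finset.univ.erase i, a {i, k} ^ 2 = 4 * ρ i := by
      rw [hρi, Finset.mul_sum]
      refine Finset.sum_congr rfl fun k hk => ?_
      rw [Finset.mem_erase] at hk
      rw [ha2' i k (Ne.symm hk.1)]; ring
    linarith
  obtain ⟨Bi, hBi⟩ : ∃ Bi : Fin N → ℝ,
      Bi = fun i => ∑ k ∈ Finset.univ.erase i, mm i k ^ 2 * d {k} := ⟨_, rfl⟩
  have hBii : ∀ i, Bi i = ∑ k ∈ Finset.univ.erase i, mm i k ^ 2 * d {k} := fun i => by rw [hBi]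
  have hBi0 : ∀ i, 0 ≤ Bi i := fun i => by
    rw [hBii]; exact Finset.sum_nonneg fun k _ => mul_nonneg (sq_nonneg _) (hd0 _)
  have hsplit : ∀ (i : Fin N) (s : ℝ) (g : Fin N → ℝ),
      ∑ k, (if k = i then 1 else s * mm i k) * g k =
        g i + s * ∑ k ∈ Finset.univ.erase i, mm i k * g k := by
    intro i s g
    rw [← Finset.add_sum_erase Finset.univ _ (Finset.mem_univ i), if_pos rfl, one_mul, Finset.mul_sum]
    congr 1
    refine Finset.sum_congr rfl fun k hk => ?_
    rw [Finset.mem_erase] at hk; rw [if_neg hk.1]; ring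
  have hP2 : ∀ (i : Fin N) (s : ℝ), 2 * s * ρ i ≤ d {i} + s ^ 2 * Bi i := by
    intro i s
    have h := hQI 0 (fun k => if k = i then 1 else s * mm i k)
    have hL : 2 * s * ρ i ≤
        ∑ j, (0 * α j ∅ + ∑ k, (if k = i then 1 else s * mm i k) * α j {k}) ^ 2 := by
      have e : ∀ j, 2 * s * (α j {i} * ∑ k ∈ Finset.univ.erase i, mm i k * α j {k}) ≤
          (0 * α j ∅ + ∑ k, (if k = i then 1 else s * mm i k) * α j {k}) ^ 2 := by
        intro j; rw [hsplit i s (fun k => α j {k})]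
        nlinarith [sq_nonneg (α j {i}), sq_nonneg (s * ∑ k ∈ Finset.univ.erase i, mm i k * α j {k}),
          sq_nonneg (α j {i} - s * ∑ k ∈ Finset.univ.erase i, mm i k * α j {k})]
      have hsum : ∑ j, 2 * s * (α j {i} * ∑ k ∈ Finset.univ.erase i, mm i k * α j {k}) =
          2 * s * ρ i := by
        rw [← Finset.mul_sum, hρi]; congr 1
        have e3 : ∀ j, α j {i} * ∑ k ∈ Finset.univ.erase i, mm i k * α j {k} =
            ∑ k ∈ Finset.univ.erase i, mm i k * (α j {i} * α j {k}) := by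
          intro j; rw [Finset.mul_sum]; exact Finset.sum_congr rfl fun k _ => by ring
        simp_rw [e3]; rw [Finset.sum_comm]
        refine Finset.sum_congr rfl fun k _ => ?_
        rw [← Finset.mul_sum, ← hmmik, sq]
      rw [← hsum]; exact Finset.sum_le_sum fun j _ => e j
    have hR : (0 : ℝ) ^ 2 * d ∅ + ∑ k, (if k = i then 1 else s * mm i k) ^ 2 * d {k} =
        d {i} + s ^ 2 * Bi i := by
      rw [hBii, ← Finset.add_sum_erase Finset.univ _ (Finset.mem_univ i), if_pos rfl, Finset.mul_sum]
      have e4 : ∑ k ∈ Finset.univ.erase i, (if k = i then 1 else s * mm i k) ^ 2 * d {k} =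
          ∑ k ∈ Finset.univ.erase i, s ^ 2 * (mm i k ^ 2 * d {k}) := by
        refine Finset.sum_congr rfl fun k hk => ?_
        rw [Finset.mem_erase] at hk; rw [if_neg hk.1]; ring
      rw [e4]; ring
    linarith [hL, h, hR.le, hR.ge]
  have hρsq : ∀ i, ρ i ^ 2 ≤ d {i} * Bi i := fun i =>
    sq_le_of_forall_quadratic (hρ0 i) (hBi0 i) (hP2 i)
  have hBisum : ∑ i, Bi i = ∑ k, d {k} * ρ k := by
    have e1 : ∀ i, Bi i = ∑ k, if k = i then 0 else mm i k ^ 2 * d {k} := by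
      intro i
      rw [hBii, ← Finset.add_sum_erase Finset.univ _ (Finset.mem_univ i), if_pos rfl, zero_add]
      exact Finset.sum_congr rfl fun k hk => by
        rw [Finset.mem_erase] at hk; rw [if_neg hk.1]
    have e2 : ∀ k, d {k} * ρ k = ∑ i, if k = i then 0 else mm i k ^ 2 * d {k} := by
      intro k
      symm
      rw [← Finset.add_sum_erase Finset.univ _ (Finset.mem_univ k), if_pos rfl, zero_add, hρi,
        Finset.mul_sum]
      refine Finset.sum_congr rfl fun i hi => ?_
      rw [Finset.mem_erase] at hi; rw [if_neg (Ne.symm hi.1), hmm_symm k i]; ring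
    simp_rw [e1, e2]; exact Finset.sum_comm
  have hBisum_le : ∑ i, Bi i ≤ τ / 16 := by
    rw [hBisum]
    calc ∑ k, d {k} * ρ k ≤ ∑ k, d {k} * (τ / 16) :=
          Finset.sum_le_sum fun k _ => mul_le_mul_of_nonneg_left (hρle k) (hd0 _)
      _ = (∑ k, d {k}) * (τ / 16) := by rw [Finset.sum_mul]
      _ ≤ 1 * (τ / 16) := mul_le_mul_of_nonneg_right hdk_le (by positivity)
      _ = τ / 16 := one_mul _
  -- V₂ = Σ_{|S|=2} a(S)² = 2 Σ_i ρ_i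
  have hV2 : ∑ S ∈ Finset.univ.filter (fun S : Finset (Fin N) => S.card = 2), a S ^ 2 =
      2 * ∑ i, ρ i := by
    have h := two_mul_sum_card_two (fun S => a S ^ 2)
    have e : ∀ i, ∑ k ∈ Finset.univ.erase i, a {i, k} ^ 2 = 4 * ρ i := by
      intro i; rw [hρi, Finset.mul_sum]
      refine Finset.sum_congr rfl fun k hk => ?_
      rw [Finset.mem_erase] at hk; rw [ha2' i k (Ne.symm hk.1)]; ring
    simp_rw [e] at h
    rw [← Finset.mul_sum] at h
    linarith
  have ha3 : ∀ S : Finset (Fin N), 3 ≤ S.card → a S = 0 := by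
    intro S hS
    rw [haU]
    refine Finset.sum_eq_zero fun j _ => ?_
    have hl : IsLevelLE 1 (evalBool (q j)) := fun T hT => hα2 j T (by omega)
    exact (IsLevelLE.mul hl hl) S (by omega)
  -- Var = V₁ + V₂
  have hVar : boolVariance p = ∑ k, a {k} ^ 2 +
      ∑ S ∈ Finset.univ.filter (fun S : Finset (Fin N) => S.card = 2), a S ^ 2 := by
    rw [boolVariance_eq_sum_sq_fourier, ← ha]
    have hf3 : ∀ S : Finset (Fin N), 3 ≤ S.card → (if S = ∅ then (0 : ℝ) else a S ^ 2) = 0 := by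
      intro S hS; rw [ha3 S hS]; simp
    rw [← Finset.sum_filter_add_sum_filter_not Finset.univ (fun S : Finset (Fin N) => S.card ≤ 1)]
    rw [← Finset.sum_filter_add_sum_filter_not
      (Finset.univ.filter fun S : Finset (Fin N) => ¬ S.card ≤ 1) (fun S : Finset (Fin N) => S.card = 2)]
    have e1 : ∑ S ∈ Finset.univ.filter (fun S : Finset (Fin N) => S.card ≤ 1),
        (if S = ∅ then (0 : ℝ) else a S ^ 2) = ∑ k, a {k} ^ 2 := by
      have hg := sum_level_le_one
        (fun S : Finset (Fin N) => if S.card ≤ 1 then (if S = ∅ then (0 : ℝ) else a S ^ 2) else 0)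
        (fun S hS => if_neg (show ¬ S.card ≤ 1 by omega))
      rw [Finset.sum_filter, hg]
      simp [Finset.singleton_ne_empty]
    have e2 : (Finset.univ.filter fun S : Finset (Fin N) => ¬ S.card ≤ 1).filter
        (fun S => S.card = 2) = Finset.univ.filter (fun S : Finset (Fin N) => S.card = 2) := by
      ext S; simp only [Finset.mem_filter, Finset.mem_univ, true_and]
      constructor
      · exact fun h => h.2
      · intro h; exact ⟨by omega, h⟩
    have e3 : ∑ S ∈ (Finset.univ.filter fun S : Finset (Fin N) => ¬ S.card ≤ 1).filter
        (fun S => ¬ S.card = 2), (if S = ∅ then (0 : ℝ) else a S ^ 2) = 0 := by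
      refine Finset.sum_eq_zero fun S hS => ?_
      simp only [Finset.mem_filter, Finset.mem_univ, true_and] at hS
      exact hf3 S (by omega)
    have e4 : ∑ S ∈ Finset.univ.filter (fun S : Finset (Fin N) => S.card = 2),
        (if S = ∅ then (0 : ℝ) else a S ^ 2) =
        ∑ S ∈ Finset.univ.filter (fun S : Finset (Fin N) => S.card = 2), a S ^ 2 := by
      refine Finset.sum_congr rfl fun S hS => ?_
      simp only [Finset.mem_filter, Finset.mem_univ, true_and] at hS
      have : S ≠ ∅ := by intro h; rw [h] at hS; simp at hS
      rw [if_neg this]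
    rw [e1, e2, e3, e4, add_zero]
  -- assemble: Var ≤ (3/2)√τ
  have hVar0 : 0 ≤ boolVariance p := boolVariance_nonneg p
  obtain ⟨t, ht⟩ : ∃ t : ℝ, t = Real.sqrt τ := ⟨_, rfl⟩
  have ht0 : 0 ≤ t := by rw [ht]; exact Real.sqrt_nonneg _
  have htt : t ^ 2 = τ := by rw [ht, Real.sq_sqrt hτ0]
  have hV1le : ∑ k, a {k} ^ 2 ≤ t := by
    rw [hV1]
    have h4 : 0 ≤ 4 * S₀ := by positivity
    exact (pow_le_pow_iff_left₀ h4 ht0 two_ne_zero).mp (by rw [htt]; exact hV1sq)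
  have hV2le : 2 * ∑ i, ρ i ≤ t / 2 := by
    by_cases hτz : τ = 0
    · have hρz : ∀ i, ρ i = 0 := by
        intro i
        have h1 := hρsq i
        have hle : Bi i ≤ ∑ i', Bi i' :=
          Finset.single_le_sum (f := Bi) (fun i' _ => hBi0 i') (Finset.mem_univ i)
        have hBiz : Bi i = 0 := by
          have := hBisum_le; rw [hτz] at this; linarith [hBi0 i]
        rw [hBiz, mul_zero] at h1
        nlinarith [hρ0 i]
      have : ∑ i, ρ i = 0 := Finset.sum_eq_zero fun i _ => hρz i
      rw [this]; linarith
    · have hτpos : 0 < τ := lt_of_le_of_ne hτ0 (Ne.symm hτz)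
      have htpos : 0 < t := by rw [ht]; exact Real.sqrt_pos.mpr hτpos
      have hlam : 0 < t / 4 := by positivity
      have hρb : ∀ i, 2 * ρ i ≤ (t / 4) * d {i} + Bi i / (t / 4) := fun i =>
        two_mul_le_of_sq_le (hρ0 i) (hd0 _) (hBi0 i) hlam (hρsq i)
      have hsum : 2 * ∑ i, ρ i ≤ (t / 4) * ∑ i, d {i} + (∑ i, Bi i) / (t / 4) := by
        rw [Finset.mul_sum, Finset.mul_sum, Finset.sum_div, ← Finset.sum_add_distrib]
        exact Finset.sum_le_sum fun i _ => hρb i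
      have h1 : (t / 4) * ∑ i, d {i} ≤ t / 4 := by
        have := mul_le_mul_of_nonneg_left hdk_le hlam.le
        rwa [mul_one] at this
      have h2 : (∑ i, Bi i) / (t / 4) ≤ (τ / 16) / (t / 4) :=
        div_le_div_of_nonneg_right hBisum_le hlam.le
      have h3 : (τ / 16) / (t / 4) = t / 4 := by
        rw [← htt]; field_simp; ring
      linarith [hsum, h1, h2, h3.le]
  have hVarle : boolVariance p ≤ 3 / 2 * t := by
    rw [hVar, hV2]; linarith [hV1le, hV2le]
  have hsq : boolVariance p ^ 2 ≤ (3 / 2 * t) ^ 2 := pow_le_pow_left₀ hVar0 hVarle 2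
  rw [← hτ]
  nlinarith [hsq, htt]

/-- **`SosSandwich.OneQueryFrameAA`** (stmt-QuantumAdvantage-15240): the `T = 1` case of PB-AA with
explicit constants — if `p` and `1 - p` are sums of squares of polynomials of total degree `≤ 1` on
the cube and `Var[p] > 0`, some variable has `4·Var[p]² ≤ 9·Inf_i[p]` (tree conventions). Flat Gram
matrix `0 ≼ M ≼ D` (diagonal, `tr D = 1`) ⇒ `V₁ ≤ √τ`, `V₂ ≤ √τ/2`.
[cite: ODonnell2014, §1.4 and §2.2] [cite: KaniewskiLeeDewolf2015, Thm. 12] -/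
theorem OneQueryFrameAA_proof :
    Summit.QuantumAdvantage.QuantumAdvantage.Theses.SosSandwich.OneQueryFrameAA := by
  unfold Summit.QuantumAdvantage.QuantumAdvantage.Theses.SosSandwich.OneQueryFrameAA
  intro N p ev avg hK hvar
  obtain ⟨m, q, r, hdeg, hval⟩ := hK
  classical
  rcases Nat.eq_zero_or_pos N with hN | hN
  · exfalso
    subst hN
    have h0 : boolVariance p = 0 := by
      unfold boolVariance boolAvg
      rw [Fintype.sum_unique, Fintype.sum_unique]
      simp
    have h0' : (avg fun x => (ev p x - avg (ev p)) ^ 2) = 0 := h0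
    linarith
  · haveI : Nonempty (Fin N) := ⟨⟨0, hN⟩⟩
    obtain ⟨i₀, -, hmax⟩ :=
      Finset.exists_max_image Finset.univ (fun i => influence i p) Finset.univ_nonempty
    refine ⟨i₀, ?_⟩
    show 4 * boolVariance p ^ 2 ≤ 9 * influence i₀ p
    exact four_var_sq_le_nine_maxInf q r hdeg (fun x => hval x) i₀
      (fun k => hmax k (Finset.mem_univ k))

end Summit.QuantumAdvantage.QuantumAdvantage.Theorems.SosSandwich
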